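import Mathlib
import Summits.QuantumFields.YangMills.Theses.BackwardLiouvilleRigidity
import Summits.QuantumFields.YangMills.Theorems.BackwardLiouvilleRigidityOneStepBackwardContractionPotentialForm

/-!
# Line «backward-liouville-rigidity» — BC3 skeleton of the ADMISSIBLE ORGAN `OneStepBackwardContractionAdm` (stmt-QuantumFields-23156, rev 5)
of route `route-QuantumFields-BackwardLiouvilleRigidity` (ym-r3-idea-1 g12; closes rung R3 `T3YM3TorusStatement.YM3TorusSU2`, not the summit).

Rev 5 (idea-crit-5 #129a/#134/#143, REPAIR-DUTY shape) ADDED the repaired organ = the rev-4 organ 27939 with the binders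
`0 < b₀ → 0 < p₀ → AdmissibleClassParams F γ b₀ p₀ prm →` (C′_R2: the class-parameter schedule must be Bałaban-admissible, which pins the
reference one-step fibre laws and excludes the twisted reference fibre pair at degenerate parameters of Lines/organ_twisted_fibre.lean); the
rev-4 decl stays in the route file as an ASIDE (negative edge).  This file is the rev-3/4 skeleton Lines/backward_liouville_rigidity.lean with the
SAME two cuts, re-registered on the new item:
* `stub_twoComponentStepAdm` (XL) — `stub_twoComponentStep` with the same three binders inserted (#129a (ii): the HOLD on the unpinned stub is
  thereby resolved — nobody should prove the unpinned form); the two-component bound (marginal profile a′ ≤ (1+ε_j)a + Cw + Ca² + δ_j, clustered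
  remainder w′ ≤ λw + ε_j a + C(a+w)w + δ_j, λ < 1, summable floor δ with the decay the termination consumes) for ADMISSIBLE prm only;
* `stub_potentialForm` (S) — verbatim; ALREADY LANDED as `Summit.QuantumFields.YangMills.Theorems.BackwardLiouvilleRigidity.stub_potentialForm`
  (p639981, module Theorems/BackwardLiouvilleRigidityOneStepBackwardContractionPotentialForm.lean), so it is discharged here by that theorem (no sorry);
* the composition `OneStepBackwardContractionAdm_of` (kernel-checked) and the by-name form `oneStepBackwardContractionAdm_of_stubs` concluding the
  crux constant.  Exactly ONE sorry (the XL stub).  No summit, rung or crux is proved here.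
-/

namespace Summit.QuantumFields.YangMills.Cruxes.OneStepBackwardContractionAdm.BackwardLiouville

open scoped BigOperators Topology Classical MeasureTheory Matrix
open Filter Set Function TopologicalSpace MeasureTheory
open Summit.QuantumFields.YangMills.Theses.BackwardLiouvilleRigidity

/-- stub (XL): the two-component one-step bound (with large-field floor) for differences of class trajectories with an ADMISSIBLE parameter
schedule (`0 < b₀`, `0 < p₀`, `AdmissibleClassParams F γ b₀ p₀ prm`). -/
theorem stub_twoComponentStepAdm :
    open MeasureTheory Filter Topology Literature.MathematicalPhysics.QuantumFieldTheory.Balaban1983to89 T3ContinuumYM3Torus T3NestedUnitLaws T3UnitLawDensityEML BalabanUVClass T3UnitScaleTilt in ∃ γ₁ : ℝ, 0 < γ₁ ∧ ∀ (F : T3Family) (γ : ℝ), 0 < γ → γ ≤ γ₁ → ∀ (b₀ p₀ κ : ℝ) (j₀ : ℕ) (prm : ℕ → ClassParams) (η : ℕ → ℝ), 0 < b₀ → 0 < p₀ → AdmissibleClassParams F γ b₀ p₀ prm → 0 < κ → (∀ j, 0 ≤ η j) → Summable η → ∀ (μ μ' : ((j : ℕ) → MeasureTheory.Measure (GaugeField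 (F.P j) 0 ↥(Matrix.specialUnitaryGroup (Fin 2) ℂ)))) (ρ ρ' : ((j : ℕ) → GaugeField (F.P j) 0 ↥(Matrix.specialUnitaryGroup (Fin 2) ℂ) → ℝ)), (∀ j : ℕ, IsProbabilityMeasure (μ j) ∧ μ j = Measure.map (descend F ℰp j) (μ (j + 1))) → (∀ j : ℕ, IsProbabilityMeasure (μ' j) ∧ μ' j = Measure.map (descend F ℰp j) (μ' (j + 1))) → (∀ j : ℕ, j₀ ≤ j → ((∀ U, PlaqSmall (θBal F.L γ b₀ p₀ j) U → 0 < ρ j U ∧ 0 < ρ' j U) ∧ μ j = (fieldMeasure _ _ _).withDensity (fun U => ENNReal.ofReal (ρ j U)) ∧ μ' j = (fieldMeasure _ _ _).withDensity (fun U => ENNReal.ofReal (ρ' j U)) ∧ MemAtHeight F ℰp j (prm j) (ρ j) ∧ MemAtHeight F ℰp j (prm j) (ρ' j) ∧ μ j {U | ¬ PlaqSmall (θBal F.L γ b₀ p₀ j) U} ≤ ENNReal.ofReal (η j) ∧ μ' j {U | ¬ PlaqSmall (θBal F.L γ b₀ p₀ j) U} ≤ ENNReal.ofReal (η j) ∧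 (ContinuousOn (ρ j) {U | PlaqSmall (θBal F.L γ b₀ p₀ j) U} ∧ ContinuousOn (ρ' j) {U | PlaqSmall (θBal F.L γ b₀ p₀ j) U}))) → ∃ (l C w₀ : ℝ) (ε δ : ℕ → ℝ) (j₁ : ℕ), 0 ≤ l ∧ l < 1 ∧ 0 ≤ C ∧ 0 < w₀ ∧ (∀ j, 0 ≤ ε j ∧ 0 ≤ δ j) ∧ Summable ε ∧ Summable δ ∧ Summable (fun i => ∑' k, δ (k + i)) ∧ Tendsto (fun j => (∑' k, δ (k + j)) * ((1 + 2 * ((F.L : ℝ) ^ j / γ) * (Fintype.card (Plaq (F.P j) 0) : ℝ)) * (Fintype.card (PBond (F.P j) 0) : ℝ) ^ 2)) atTop (𝓝 0) ∧ j₀ ≤ j₁ ∧ ∀ j ≥ j₁, ∀ (c : Plaq (F.P (j + 1)) 0 → ℝ) a w, 0 ≤ a → 0 ≤ w → a + w ≤ w₀ → ((∀ p, |c p| ≤ a) ∧ (∀ (b b' : PBond (F.P (j + 1)) 0) U V W Z, PlaqSmall (θBal F.L γ b₀ p₀ (j + 1)) U → PlaqSmall (θBal F.L γ b₀ p₀ (j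 + 1)) V → PlaqSmall (θBal F.L γ b₀ p₀ (j + 1)) W → PlaqSmall (θBal F.L γ b₀ p₀ (j + 1)) Z → (∀ e, e ≠ b → U e = V e) → (∀ e, e ≠ b' → U e = W e) → (∀ e, e ≠ b' → V e = Z e) → (∀ e, e ≠ b → W e = Z e) → |(Real.log (ρ (j + 1) U) - Real.log (ρ' (j + 1) U) - ((F.L : ℝ) ^ (j + 1) / γ) * ∑ p, c p * (1 - reTr (GaugeField.plaqHol U p))) - (Real.log (ρ (j + 1) V) - Real.log (ρ' (j + 1) V) - ((F.L : ℝ) ^ (j + 1) / γ) * ∑ p, c p * (1 - reTr (GaugeField.plaqHol V p))) - ((Real.log (ρ (j + 1) W) - Real.log (ρ' (j + 1) W) - ((F.L : ℝ) ^ (j + 1) / γ) * ∑ p, c p * (1 - reTr (GaugeField.plaqHol W p))) - (Real.log (ρ (j + 1) Z) - Real.log (ρ' (j + 1) Z) - ((F.L : ℝ) ^ (j + 1) / γ) * ∑ p, c p * (1 - reTr (GaugeField.plaqHol Z p))))| ≤ w * Real.exp (-(κ * (b.src.tdist b'.src : ℝ))))) → ∃ (c' : Plaq (F.P j) 0 →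 ℝ) (a' w' : ℝ), 0 ≤ a' ∧ 0 ≤ w' ∧ a' ≤ (1 + ε j) * a + C * w + C * a ^ 2 + δ j ∧ w' ≤ l * w + ε j * a + C * (a + w) * w + δ j ∧ ((∀ p, |c' p| ≤ a') ∧ (∀ (b b' : PBond (F.P j) 0) U V W Z, PlaqSmall (θBal F.L γ b₀ p₀ j) U → PlaqSmall (θBal F.L γ b₀ p₀ j) V → PlaqSmall (θBal F.L γ b₀ p₀ j) W → PlaqSmall (θBal F.L γ b₀ p₀ j) Z → (∀ e, e ≠ b → U e = V e) → (∀ e, e ≠ b' → U e = W e) → (∀ e, e ≠ b' → V e = Z e) → (∀ e, e ≠ b → W e = Z e) → |(Real.log (ρ j U) - Real.log (ρ' j U) - ((F.L : ℝ) ^ j / γ) * ∑ p, c' p * (1 - reTr (GaugeField.plaqHol U p))) - (Real.log (ρ j V) - Real.log (ρ' j V) - ((F.L : ℝ) ^ j / γ) * ∑ p, c' p * (1 - reTr (GaugeField.plaqHol V p))) - ((Real.log (ρ j W) - Real.log (ρ' j W) - ((F.L : ℝ) ^ j / γ) * ∑ p, c' p * (1 - reTr (GaugeField.plaqHol W p)))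 - (Real.log (ρ j Z) - Real.log (ρ' j Z) - ((F.L : ℝ) ^ j / γ) * ∑ p, c' p * (1 - reTr (GaugeField.plaqHol Z p))))| ≤ w' * Real.exp (-(κ * (b.src.tdist b'.src : ℝ))))) := by
  sorry

/-- stub (S, CLOSED): two-component bounds with `λ < 1` and a floor fold into the potential form — the landed theorem, by name. -/
theorem stub_potentialForm :
    ∀ (lam C : ℝ), 0 ≤ lam → lam < 1 → 0 ≤ C → ∃ θ C' : ℝ, 1 ≤ θ ∧ 0 ≤ C' ∧ ∀ (e d a w a' w' : ℝ), 0 ≤ e → 0 ≤ d → 0 ≤ a → 0 ≤ w → 0 ≤ a' → 0 ≤ w' → a' ≤ (1 + e) * a + C * w + C * a ^ 2 + d → w' ≤ lam * w + e * a + C * (a + w) * w + d → a' + θ * w' ≤ (1 + (θ + 1) * e + C' * (a + θ * w)) * (a + θ * w) + (θ + 1) * d :=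
  Summit.QuantumFields.YangMills.Theorems.BackwardLiouvilleRigidity.stub_potentialForm

/-- Local reducible alias of the crux (conclusion of the hypothesised composition; the registrar then selects the by-name form). -/
abbrev OrganGoal : Prop := OneStepBackwardContractionAdm

/-- BC3 composition: the two stubs give the admissible organ exactly as filed (rev 5); concluded as the reducible alias `OrganGoal`. -/
theorem OneStepBackwardContractionAdm_of
    (h2 : open MeasureTheory Filter Topology Literature.MathematicalPhysics.QuantumFieldTheory.Balaban1983to89 T3ContinuumYM3Torus T3NestedUnitLaws T3UnitLawDensityEML BalabanUVClass T3UnitScaleTilt in ∃ γ₁ : ℝ, 0 < γ₁ ∧ ∀ (F : T3Family) (γ : ℝ), 0 < γ → γ ≤ γ₁ → ∀ (b₀ p₀ κ : ℝ) (j₀ : ℕ) (prm : ℕ → ClassParams) (η : ℕ → ℝ), 0 < b₀ → 0 < p₀ → AdmissibleClassParams F γ b₀ p₀ prm → 0 < κ → (∀ j, 0 ≤ η j) → Summable η → ∀ (μ μ' : ((j : ℕ) → MeasureTheory.Measure (GaugeField (F.P j) 0 ↥(Matrix.specialUnitaryGroup (Fin 2) ℂ)))) (ρ ρ' : ((j :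 ℕ) → GaugeField (F.P j) 0 ↥(Matrix.specialUnitaryGroup (Fin 2) ℂ) → ℝ)), (∀ j : ℕ, IsProbabilityMeasure (μ j) ∧ μ j = Measure.map (descend F ℰp j) (μ (j + 1))) → (∀ j : ℕ, IsProbabilityMeasure (μ' j) ∧ μ' j = Measure.map (descend F ℰp j) (μ' (j + 1))) → (∀ j : ℕ, j₀ ≤ j → ((∀ U, PlaqSmall (θBal F.L γ b₀ p₀ j) U → 0 < ρ j U ∧ 0 < ρ' j U) ∧ μ j = (fieldMeasure _ _ _).withDensity (fun U => ENNReal.ofReal (ρ j U)) ∧ μ' j = (fieldMeasure _ _ _).withDensity (fun U => ENNReal.ofReal (ρ' j U)) ∧ MemAtHeight F ℰp j (prm j) (ρ j) ∧ MemAtHeight F ℰp j (prm j) (ρ' j) ∧ μ j {U | ¬ PlaqSmall (θBal F.L γ b₀ p₀ j) U} ≤ ENNReal.ofReal (η j) ∧ μ' j {U | ¬ PlaqSmall (θBal F.L γ b₀ p₀ j) U} ≤ ENNReal.ofReal (η j) ∧ (ContinuousOn (ρ j) {U | PlaqSmall (θBal F.L γ b₀ p₀ j) U} ∧ ContinuousOn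 (ρ' j) {U | PlaqSmall (θBal F.L γ b₀ p₀ j) U}))) → ∃ (l C w₀ : ℝ) (ε δ : ℕ → ℝ) (j₁ : ℕ), 0 ≤ l ∧ l < 1 ∧ 0 ≤ C ∧ 0 < w₀ ∧ (∀ j, 0 ≤ ε j ∧ 0 ≤ δ j) ∧ Summable ε ∧ Summable δ ∧ Summable (fun i => ∑' k, δ (k + i)) ∧ Tendsto (fun j => (∑' k, δ (k + j)) * ((1 + 2 * ((F.L : ℝ) ^ j / γ) * (Fintype.card (Plaq (F.P j) 0) : ℝ)) * (Fintype.card (PBond (F.P j) 0) : ℝ) ^ 2)) atTop (𝓝 0) ∧ j₀ ≤ j₁ ∧ ∀ j ≥ j₁, ∀ (c : Plaq (F.P (j + 1)) 0 → ℝ) a w, 0 ≤ a → 0 ≤ w → a + w ≤ w₀ → ((∀ p, |c p| ≤ a) ∧ (∀ (b b' : PBond (F.P (j + 1)) 0) U V W Z, PlaqSmall (θBal F.L γ b₀ p₀ (j + 1)) U → PlaqSmall (θBal F.L γ b₀ p₀ (j + 1)) V → PlaqSmall (θBal F.L γ b₀ p₀ (j + 1)) W → PlaqSmall (θBal F.L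 γ b₀ p₀ (j + 1)) Z → (∀ e, e ≠ b → U e = V e) → (∀ e, e ≠ b' → U e = W e) → (∀ e, e ≠ b' → V e = Z e) → (∀ e, e ≠ b → W e = Z e) → |(Real.log (ρ (j + 1) U) - Real.log (ρ' (j + 1) U) - ((F.L : ℝ) ^ (j + 1) / γ) * ∑ p, c p * (1 - reTr (GaugeField.plaqHol U p))) - (Real.log (ρ (j + 1) V) - Real.log (ρ' (j + 1) V) - ((F.L : ℝ) ^ (j + 1) / γ) * ∑ p, c p * (1 - reTr (GaugeField.plaqHol V p))) - ((Real.log (ρ (j + 1) W) - Real.log (ρ' (j + 1) W) - ((F.L : ℝ) ^ (j + 1) / γ) * ∑ p, c p * (1 - reTr (GaugeField.plaqHol W p))) - (Real.log (ρ (j + 1) Z) - Real.log (ρ' (j + 1) Z) - ((F.L : ℝ) ^ (j + 1) / γ) * ∑ p, c p * (1 - reTr (GaugeField.plaqHol Z p))))| ≤ w * Real.exp (-(κ * (b.src.tdist b'.src : ℝ))))) → ∃ (c' : Plaq (F.P j) 0 → ℝ) (a' w' : ℝ), 0 ≤ a' ∧ 0 ≤ w' ∧ a' ≤ (1 + ε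 j) * a + C * w + C * a ^ 2 + δ j ∧ w' ≤ l * w + ε j * a + C * (a + w) * w + δ j ∧ ((∀ p, |c' p| ≤ a') ∧ (∀ (b b' : PBond (F.P j) 0) U V W Z, PlaqSmall (θBal F.L γ b₀ p₀ j) U → PlaqSmall (θBal F.L γ b₀ p₀ j) V → PlaqSmall (θBal F.L γ b₀ p₀ j) W → PlaqSmall (θBal F.L γ b₀ p₀ j) Z → (∀ e, e ≠ b → U e = V e) → (∀ e, e ≠ b' → U e = W e) → (∀ e, e ≠ b' → V e = Z e) → (∀ e, e ≠ b → W e = Z e) → |(Real.log (ρ j U) - Real.log (ρ' j U) - ((F.L : ℝ) ^ j / γ) * ∑ p, c' p * (1 - reTr (GaugeField.plaqHol U p))) - (Real.log (ρ j V) - Real.log (ρ' j V) - ((F.L : ℝ) ^ j / γ) * ∑ p, c' p * (1 - reTr (GaugeField.plaqHol V p))) - ((Real.log (ρ j W) - Real.log (ρ' j W) - ((F.L : ℝ) ^ j / γ) * ∑ p, c' p * (1 - reTr (GaugeField.plaqHol W p))) - (Real.log (ρ j Z) - Real.log (ρ' j Z) - ((F.L : ℝ) ^ j / γ) * ∑ p,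 c' p * (1 - reTr (GaugeField.plaqHol Z p))))| ≤ w' * Real.exp (-(κ * (b.src.tdist b'.src : ℝ))))))
    (hP : ∀ (lam C : ℝ), 0 ≤ lam → lam < 1 → 0 ≤ C → ∃ θ C' : ℝ, 1 ≤ θ ∧ 0 ≤ C' ∧ ∀ (e d a w a' w' : ℝ), 0 ≤ e → 0 ≤ d → 0 ≤ a → 0 ≤ w → 0 ≤ a' → 0 ≤ w' → a' ≤ (1 + e) * a + C * w + C * a ^ 2 + d → w' ≤ lam * w + e * a + C * (a + w) * w + d → a' + θ * w' ≤ (1 + (θ + 1) * e + C' * (a + θ * w)) * (a + θ * w) + (θ + 1) * d) :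
    OrganGoal := by
  classical
  obtain ⟨γ₁, hγ₁, h⟩ := h2
  refine ⟨γ₁, hγ₁, fun F γ hγ hle b₀ p₀ κ j₀ prm η hb₀ hp₀ hadm hκ hpos hη μ μ' ρ ρ' hc hc' hB => ?_⟩
  obtain ⟨lam, C, w₀, ε, δ, j₁, hlam0, hlam1, hC, hw₀, hεδ, hεs, hδs, hDs, hdec, hj, hstep⟩ :=
    h F γ hγ hle b₀ p₀ κ j₀ prm η hb₀ hp₀ hadm hκ hpos hη μ μ' ρ ρ' hc hc' hB
  obtain ⟨θ, C', hθ1, hC', halg⟩ := hP lam C hlam0 hlam1 hC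
  have hθ0 : 0 ≤ θ + 1 := by linarith
  refine ⟨θ, C', w₀, fun j => (θ + 1) * ε j, fun j => (θ + 1) * δ j, j₁, by linarith, hC', hw₀, fun j => ?_, hεs.mul_left _,
    hδs.mul_left _, ?_, ?_, hj, ?_⟩
  · exact ⟨mul_nonneg hθ0 (hεδ j).1, mul_nonneg hθ0 (hεδ j).2⟩
  · refine (hDs.mul_left (θ + 1)).congr fun i => ?_
    beta_reduce
    rw [tsum_mul_left]
  · have h := hdec.const_mul (θ + 1)
    rw [mul_zero] at h
    refine Filter.Tendsto.congr (fun j => ?_) h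
    beta_reduce
    rw [tsum_mul_left]
    ring
  intro j hjj c a w ha hw hV hadm
  have haw : a + w ≤ w₀ := by nlinarith
  obtain ⟨c', a', w', ha', hw', hA, hW, hadm'⟩ := hstep j hjj c a w ha hw haw hadm
  exact ⟨c', a', w', ha', hw', halg (ε j) (δ j) a w a' w' (hεδ j).1 (hεδ j).2 ha hw ha' hw' hA hW, hadm'⟩

/-- The composition applied to the stubs: the admissible organ BY NAME, modulo exactly the one sorry above. -/
theorem oneStepBackwardContractionAdm_of_stubs :
    Summit.QuantumFields.YangMills.Theses.BackwardLiouvilleRigidity.OneStepBackwardContractionAdm :=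
  OneStepBackwardContractionAdm_of stub_twoComponentStepAdm stub_potentialForm

end Summit.QuantumFields.YangMills.Cruxes.OneStepBackwardContractionAdm.BackwardLiouville
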